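/-
Copyright (c) 2026 the pub-hodgecm-mathlib formalisation cell (harness21).  Prover seat hodgecm-mathlib-LH4-p12 (g3), Track A «(D-RAM) FOUR-FRAME», unit U2H, the census leaf
(ρ2b′-X) — PAYER-PLAN-rho2bX v1 brick T1 «norm-residue glue counts», the VALUES below the conductor.  2026-09-04.
-/
import Literature.NumberTheory.LocalFields.WildQuadraticDatumNormFibres      -- ★ (this seat): translation, `#Sol_2(1) = q`, the lifting step, the trace estimate
import Literature.NumberTheory.LocalFields.WildQuadraticEisensteinFrame      -- ★ `exists_fixed_coords_of_map_ne`, `v_fixed_add_fixed_mul_le_one_iff` (coordinates over the fixed field)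
import Mathlib.Topology.Algebra.Valued.LocallyCompact                        -- `Valued.integer.finite_quotient_maximalIdeal_pow_of_finite_residueField`
import HarnessLib

/-!
# Norm fibres of a WILD ramified quadratic datum, II: the layer count and the VALUES `#{x mod 𝓂^{2a} : x·σ̄x ≡ 1} = q^a` below the conductor
# (Serre, *Local Fields* V §3; Labesse–Langlands 1979 §2 «`δ_m`»)

Topic `NumberTheory/LocalFields`; namespace `Literature.NumberTheory.LocalFields.WildQuadraticDatum`.  THEOREMS ONLY (no definition, no instance, no notation, no named fact, no
`sorry`); kernel lane `--supports stmt-HodgeConjecture-24833` (count-neutral).  Cell `pub/hodgecm-mathlib` (D-0151), crux H413, Track A «(D-RAM) FOUR-FRAME», unit U2H, census leaf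
(ρ2b′-X): second half of PAYER-PLAN-rho2bX v1 brick T1 (the glue count `A(a, ξ)` of the toric∕order reduction, LH4-p12 (g3)).  ★ Part I (`WildQuadraticDatumNormFibres`) proved:
translation, class-blindness below the conductor, norm-gating above it, `#Sol_2(1) = q` and the lifting step `#Sol_{2a+2}(1) = q²·#G_a` with
`Sol_n(r) := {x : 𝒪 ⧸ 𝓂^n // ∃ u, mk u = x ∧ |uσu − r| ≤ |ϖ^n|}`, `G_a := {x : 𝒪 ⧸ 𝓂^{2a} // ∃ u, mk u = x ∧ |uσu − 1| ≤ |ϖ^{2a+2}|}`.  THIS FILE adds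
* §1 translation with separate quotient and tolerance exponents (`𝓂^n`, `|ϖ^m|`);
* §2 fixed lifts of residues (coordinates over the fixed field, ★ `exists_fixed_coords_of_map_ne`);
* §3 **THE LAYER COUNT**: if every fixed unit `w ≡ 1 (mod 𝓂^{2a})` is a norm to tolerance `|ϖ^{2a+2}|`, then `#Sol_{2a}(1) = q · #G_a` — the classes of `Sol_{2a}(1)` are sorted by the
  residue of `(uσu − 1)∕(ϖσϖ)^a`, each of the `q` residues is hit, and the `q` blocks are translates of `G_a`;
* §4 **THE VALUES BELOW THE CONDUCTOR**: for `1 ≤ a ≤ d − 1`, **`#Sol_{2a}(1) = q^a`**, hence (★ Part I §3) `#Sol_{2a}(r) = q^a` for every fixed unit `r` — the class-blind glue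
  count `A(a, ξ) = q^a` of the wild census (model: LH4-p12 (g3) `toric_census.v1`, `glue_A_bruteforce`, 9 wild cells).
NOT here (honest scope): the break layer `a = d − 1 → d` (exactly half of the `q` classes are norms), which gives `#Sol_{2a}(1) = 2q^a` for `a ≥ d`.
HONEST LABEL: HC_CM is proved only modulo the 7 printed citations (2 remaining named inputs: hLiu418 = stmt-HodgeConjecture-24832, h413 = stmt-HodgeConjecture-24833) until rung 0
closes; unconditional local algebra, count-neutral.

## References
* [Serre1979] J.-P. Serre, *Local Fields*, GTM 67 (1979): Ch. V §3 Prop. 5, Cor. 2–3 pp. 84–86; Ch. IV §2 Prop. 6; Ch. I §6 Prop. 18 (`𝒪_E = 𝒪_F ⊕ 𝒪_F ϖ`).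
* [LabesseLanglands1979] J.-P. Labesse, R. P. Langlands, *L-indistinguishability for SL(2)*, Canad. J. Math. 31 (1979), §2 p. 8.
-/

set_option autoImplicit false

noncomputable section

open WithZero IsLocalRing
open scoped Valued
open Literature.NumberTheory.Automorphic.UnitaryThreeFourFrame
open Literature.NumberTheory.Automorphic.UnitaryGroup (mem_maximalIdeal_pow_iff_v_le)
open Literature.NumberTheory.LocalFields (exists_fixed_coords_of_map_ne v_fixed_add_fixed_mul_le_one_iff)

namespace Literature.NumberTheory.LocalFields.WildQuadraticDatum

variable {K : Type} [Field K] [Valued K ℤᵐ⁰] {σ : K →+* K} {ϖ : K} {d t : ℕ}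

/-! ## §1 Translation with separate quotient and tolerance exponents -/

/-- **TRANSLATION (two exponents).** If `z₀` is a unit with `|z₀σz₀·r − r′| ≤ |ϖ^m|` then `x ↦ x·z̄₀` is a bijection between the classes mod `𝓂^n` having a lift `u` with
`|uσu − r| ≤ |ϖ^m|` and those with `|uσu − r′| ≤ |ϖ^m|`. [cite: Serre1979, Ch. V §3 Prop. 5] [cite: LabesseLanglands1979, §2 p. 8] -/
theorem natCard_normFibre_eq_of_approx' (hvσ : ∀ a, Valued.v (σ a) = Valued.v a)
    (n m : ℕ) {r r' z₀ : K} (hz₀ : Valued.v z₀ = 1) (h : Valued.v (z₀ * σ z₀ * r - r') ≤ Valued.v (ϖ ^ m)) :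
    Nat.card {x : 𝒪[K] ⧸ 𝓂[K] ^ n // ∃ u : 𝒪[K], Ideal.Quotient.mk (𝓂[K] ^ n) u = x ∧ Valued.v ((u : K) * σ u - r) ≤ Valued.v (ϖ ^ m)} =
      Nat.card {x : 𝒪[K] ⧸ 𝓂[K] ^ n // ∃ u : 𝒪[K], Ideal.Quotient.mk (𝓂[K] ^ n) u = x ∧ Valued.v ((u : K) * σ u - r') ≤ Valued.v (ϖ ^ m)} := by
  have hz₀0 : z₀ ≠ 0 := fun h0 => by rw [h0, map_zero] at hz₀; exact zero_ne_one hz₀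
  have hσz₀0 : Valued.v (σ z₀) ≠ 0 := by rw [hvσ, hz₀]; exact one_ne_zero
  have hσz₀ne : σ z₀ ≠ 0 := (Valuation.ne_zero_iff _).1 hσz₀0
  set zO : 𝒪[K] := ⟨z₀, hz₀.le⟩ with hzO
  set wO : 𝒪[K] := ⟨z₀⁻¹, (by rw [map_inv₀, hz₀, inv_one] : Valued.v z₀⁻¹ ≤ 1)⟩ with hwO
  have hzw : zO * wO = 1 := Subtype.ext (by simp [hzO, hwO, mul_inv_cancel₀ hz₀0])
  have hNz1 : Valued.v (z₀ * σ z₀) = 1 := by rw [map_mul, hvσ, hz₀, mul_one]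
  have hNw1 : Valued.v (z₀⁻¹ * σ z₀⁻¹) = 1 := by rw [map_mul, hvσ, map_inv₀, hz₀, inv_one, mul_one]
  have hNzw : (z₀ * σ z₀) * (z₀⁻¹ * σ z₀⁻¹) = 1 := by
    rw [map_inv₀, mul_mul_mul_comm, mul_inv_cancel₀ hz₀0, mul_inv_cancel₀ hσz₀ne, one_mul]
  set U : (𝒪[K] ⧸ 𝓂[K] ^ n)ˣ := Units.mkOfMulEqOne (Ideal.Quotient.mk (𝓂[K] ^ n) zO) (Ideal.Quotient.mk (𝓂[K] ^ n) wO)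
    (by rw [← map_mul, hzw, map_one]) with hU
  have hUval : (U : 𝒪[K] ⧸ 𝓂[K] ^ n) = Ideal.Quotient.mk (𝓂[K] ^ n) zO := Units.val_mkOfMulEqOne _
  refine Nat.card_congr (U.mulRight.subtypeEquiv fun x => ⟨?_, ?_⟩)
  · rintro ⟨u, hux, hc⟩
    refine ⟨u * zO, by rw [Units.mulRight_apply, hUval, map_mul, hux], ?_⟩
    have hcoe : ((u * zO : 𝒪[K]) : K) = (u : K) * z₀ := rfl
    have hrew : (u : K) * z₀ * σ ((u : K) * z₀) - r' = ((u : K) * σ u - r) * (z₀ * σ z₀) + (z₀ * σ z₀ * r - r') := by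
      rw [map_mul]; ring
    rw [hcoe, hrew]
    refine (Valuation.map_add _ _ _).trans (max_le ?_ h)
    rw [map_mul, hNz1, mul_one]; exact hc
  · rintro ⟨u', hux, hc⟩
    refine ⟨u' * wO, ?_, ?_⟩
    · rw [map_mul, hux, Units.mulRight_apply, hUval, mul_assoc, ← map_mul, hzw, map_one, mul_one]
    · have hcoe : ((u' * wO : 𝒪[K]) : K) = (u' : K) * z₀⁻¹ := rfl
      have hrew : (u' : K) * z₀⁻¹ * σ ((u' : K) * z₀⁻¹) - r =
          ((u' : K) * σ u' - r') * (z₀⁻¹ * σ z₀⁻¹) + (z₀⁻¹ * σ z₀⁻¹) * (r' - z₀ * σ z₀ * r) + r * ((z₀ * σ z₀) * (z₀⁻¹ * σ z₀⁻¹) - 1) := by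
        rw [map_mul]; ring
      rw [hcoe, hrew, hNzw, sub_self, mul_zero, add_zero]
      refine (Valuation.map_add _ _ _).trans (max_le ?_ ?_)
      · rw [map_mul, hNw1, mul_one]; exact hc
      · rw [map_mul, hNw1, one_mul, Valuation.map_sub_swap]; exact h

/-! ## §2 Fixed lifts of residues -/

/-- **Every integer is congruent to a fixed integer modulo `𝓂`** (`u = α + βϖ` with `α, β` fixed integers — coordinates over the fixed field). [cite: Serre1979, Ch. I §6 Prop. 18] -/
theorem exists_fixed_v_sub_le_varpi (hD : IsRamifiedQuadraticDatum σ ϖ d t) {u : K} (hu : Valued.v u ≤ 1) :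
    ∃ α : K, σ α = α ∧ Valued.v α ≤ 1 ∧ Valued.v (u - α) ≤ Valued.v ϖ := by
  obtain ⟨hσ, hvσ, hϖ, hfix, hd, hd1, ht⟩ := hD
  obtain ⟨α, β, hα, hβ, huab⟩ := exists_fixed_coords_of_map_ne hσ (map_varpi_ne hϖ hd) u
  obtain ⟨hα1, hβ1⟩ := (v_fixed_add_fixed_mul_le_one_iff (even_log_v_of_fixed hfix) hϖ hα hβ).1 (huab ▸ hu)
  refine ⟨α, hα, hα1, ?_⟩
  have hrew : u - α = β * ϖ := by rw [huab]; ring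
  rw [hrew, map_mul]
  exact mul_le_of_le_one_left' hβ1

/-- **A fixed element of `𝓂` lies in `𝓂²`** (fixed non-zero elements have even order). [cite: Serre1979, Ch. V §3] -/
theorem v_le_varpi_sq_of_fixed_of_lt_one (hD : IsRamifiedQuadraticDatum σ ϖ d t) {c : K} (hσc : σ c = c) (hc : Valued.v c < 1) :
    Valued.v c ≤ Valued.v ϖ ^ 2 := by
  have hϖ := hD.2.2.1; have hfix := hD.2.2.2.1
  have h1 : Valued.v c ≤ exp (-(2 * (0 : ℤ) + 1)) := by
    have := v_le_varpi_of_lt_one hϖ hc; rw [hϖ] at this; convert this using 2; norm_num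
  have h2 := v_le_exp_even_of_fixed hfix hσc 0 h1
  rw [v_varpi_pow hϖ]; convert h2 using 2; norm_num

/-! ## §3 The layer: blocks sorted by the residue of `(uσu − 1)∕(ϖσϖ)^a` -/

/-- **THE LAYER PARTITION.**  For `a ≥ 1` there are layer representatives `w_c = 1 + (ϖσϖ)^a·c̃` (`c ∈ 𝓀`, `c̃` a fixed integral lift of `c`) — fixed, `≡ 1 (mod 𝓂^{2a})`,
ADDITIVE to tolerance `|ϖ^{2a+2}|` (`w_c·w_{c′} ≡ w_{c+c′}`) and COMPLETE (every fixed `w ≡ 1 (mod 𝓂^{2a})` is `≡ w_c (mod |ϖ^{2a+2}|)` for some `c`) — such that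
`#Sol_{2a}(1) = Σ_c #B(w_c)`, `B(w) := {x : 𝒪 ⧸ 𝓂^{2a} // ∃ u, mk u = x ∧ |uσu − w| ≤ |ϖ^{2a+2}|}`: the classes of `Sol_{2a}(1)` are sorted by the residue of the fixed integer
`(uσu − 1)∕(ϖσϖ)^a`, well defined by ★ Part I §6. [cite: Serre1979, Ch. V §3 Prop. 5, Cor. 2–3 pp. 84–86] [cite: LabesseLanglands1979, §2 p. 8] -/
theorem exists_layer_partition [IsDiscreteValuationRing 𝒪[K]] [Finite 𝓀[K]] (hD : IsRamifiedQuadraticDatum σ ϖ d t)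
    (h2v : Valued.v (2 : K) < 1) {a : ℕ} (ha : 1 ≤ a) :
    ∃ w : 𝓀[K] → K, (∀ c, σ (w c) = w c) ∧ (∀ c, Valued.v (w c - 1) ≤ Valued.v (ϖ ^ (2 * a))) ∧
      (∀ c c', Valued.v (w c * w c' - w (c + c')) ≤ Valued.v (ϖ ^ (2 * a + 2))) ∧
      (∀ w' : K, σ w' = w' → Valued.v (w' - 1) ≤ Valued.v (ϖ ^ (2 * a)) → ∃ c, Valued.v (w' - w c) ≤ Valued.v (ϖ ^ (2 * a + 2))) ∧
      Nat.card {x : 𝒪[K] ⧸ 𝓂[K] ^ (2 * a) // ∃ u : 𝒪[K], Ideal.Quotient.mk (𝓂[K] ^ (2 * a)) u = x ∧ Valued.v ((u : K) * σ u - 1) ≤ Valued.v (ϖ ^ (2 * a))} =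
        ∑ᶠ c : 𝓀[K], Nat.card {x : 𝒪[K] ⧸ 𝓂[K] ^ (2 * a) // ∃ u : 𝒪[K], Ideal.Quotient.mk (𝓂[K] ^ (2 * a)) u = x ∧ Valued.v ((u : K) * σ u - w c) ≤ Valued.v (ϖ ^ (2 * a + 2))} := by
  classical
  obtain ⟨hσ, hvσ, hϖ, hfix, hd, hd1, ht⟩ := id hD
  haveI : Finite (𝒪[K] ⧸ 𝓂[K] ^ (2 * a)) := Valued.integer.finite_quotient_maximalIdeal_pow_of_finite_residueField inferInstance _
  haveI : Fintype 𝓀[K] := Fintype.ofFinite _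
  have hϖ0 : ϖ ≠ 0 := fun h0 => by rw [h0, map_zero] at hϖ; exact exp_ne_zero hϖ.symm
  have hϖ1 : Valued.v ϖ < 1 := by rw [hϖ, ← exp_zero, exp_lt_exp]; norm_num
  have hϖle : Valued.v ϖ ≤ 1 := hϖ1.le
  -- the fixed square-uniformiser `π = ϖσϖ` and its power
  set π : K := ϖ * σ ϖ with hπ
  have hσπ : σ π = π := by rw [hπ, map_mul, hσ, mul_comm]
  have hvπ : Valued.v π = Valued.v ϖ ^ 2 := by rw [hπ, map_mul, hvσ, sq]
  have hvπa : Valued.v (π ^ a) = Valued.v (ϖ ^ (2 * a)) := by rw [map_pow, hvπ, ← pow_mul, map_pow]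
  have hπa0 : π ^ a ≠ 0 := pow_ne_zero _ (mul_ne_zero hϖ0 (fun h0 => hϖ0 (by rw [← hσ ϖ, h0, map_zero])))
  have hσπa : σ (π ^ a) = π ^ a := by rw [map_pow, hσπ]
  have hϖ2a2 : Valued.v (ϖ ^ (2 * a + 2)) = Valued.v (ϖ ^ (2 * a)) * Valued.v ϖ ^ 2 := by rw [pow_add, map_mul, map_pow ((Valued.v)) ϖ 2]
  -- abbreviations for the two predicates
  let P : (𝒪[K] ⧸ 𝓂[K] ^ (2 * a)) → Prop := fun x =>
    ∃ u : 𝒪[K], Ideal.Quotient.mk (𝓂[K] ^ (2 * a)) u = x ∧ Valued.v ((u : K) * σ u - 1) ≤ Valued.v (ϖ ^ (2 * a))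
  let Q : K → (𝒪[K] ⧸ 𝓂[K] ^ (2 * a)) → Prop := fun w x =>
    ∃ u : 𝒪[K], Ideal.Quotient.mk (𝓂[K] ^ (2 * a)) u = x ∧ Valued.v ((u : K) * σ u - w) ≤ Valued.v (ϖ ^ (2 * a + 2))
  -- a canonical lift and the layer coordinate `γ(x) = (N(u_x) − 1) ∕ π^a`
  have hlift : ∀ x : 𝒪[K] ⧸ 𝓂[K] ^ (2 * a), ∃ u : 𝒪[K], Ideal.Quotient.mk _ u = x := Ideal.Quotient.mk_surjective
  let lift : (𝒪[K] ⧸ 𝓂[K] ^ (2 * a)) → 𝒪[K] := fun x => Classical.choose (hlift x)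
  have hlift_spec : ∀ x, Ideal.Quotient.mk (𝓂[K] ^ (2 * a)) (lift x) = x := fun x => Classical.choose_spec (hlift x)
  let γ : (𝒪[K] ⧸ 𝓂[K] ^ (2 * a)) → K := fun x => (((lift x : 𝒪[K]) : K) * σ (lift x) - 1) / π ^ a
  let Φ : (𝒪[K] ⧸ 𝓂[K] ^ (2 * a)) → 𝓀[K] := fun x =>
    if h : Valued.v (γ x) ≤ 1 then IsLocalRing.residue 𝒪[K] (⟨γ x, h⟩ : 𝒪[K]) else 0
  -- norms of two lifts of the same class agree to order `2a + 2` (★ Part I §6)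
  have hNclose : ∀ (x : 𝒪[K] ⧸ 𝓂[K] ^ (2 * a)) (u : 𝒪[K]), Ideal.Quotient.mk _ u = x →
      Valued.v (((u : K) * σ u) - ((lift x : 𝒪[K]) : K) * σ (lift x)) ≤ Valued.v (ϖ ^ (2 * a + 2)) := by
    intro x u hux
    have hsub : u - lift x ∈ 𝓂[K] ^ (2 * a) := (Ideal.Quotient.eq).1 (by rw [hux, hlift_spec])
    rw [mem_maximalIdeal_pow_iff_v_le hϖ] at hsub
    exact v_mul_map_sub_mul_map_le_pow_add_two hD h2v (lift x).2 ha (by simpa using hsub)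
  have hγfix : ∀ x, σ (γ x) = γ x := by
    intro x
    change σ (((((lift x : 𝒪[K]) : K) * σ (lift x) - 1) / π ^ a)) = (((lift x : 𝒪[K]) : K) * σ (lift x) - 1) / π ^ a
    rw [map_div₀, map_sub, map_one, map_mul_map hσ, hσπa]
  have hγeq : ∀ x, ((lift x : 𝒪[K]) : K) * σ (lift x) = 1 + π ^ a * γ x := by
    intro x
    change ((lift x : 𝒪[K]) : K) * σ (lift x) = 1 + π ^ a * ((((lift x : 𝒪[K]) : K) * σ (lift x) - 1) / π ^ a)
    rw [mul_div_cancel₀ _ hπa0]; ring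
  have hγint : ∀ x, P x → Valued.v (γ x) ≤ 1 := by
    rintro x ⟨u, hux, hc⟩
    have hc' : Valued.v (((lift x : 𝒪[K]) : K) * σ (lift x) - 1) ≤ Valued.v (ϖ ^ (2 * a)) :=
      (exists_mk_eq_iff hvσ hϖ (2 * a) 1 (lift x)).1 ⟨u, by rw [hux, hlift_spec], hc⟩
    change Valued.v ((((lift x : 𝒪[K]) : K) * σ (lift x) - 1) / π ^ a) ≤ 1
    rw [map_div₀, hvπa]
    exact div_le_one_of_le₀ hc' zero_le
  -- fixed lifts of residues: `c ↦ c̃`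
  have hres_eq : ∀ x y : 𝒪[K], IsLocalRing.residue 𝒪[K] x = IsLocalRing.residue 𝒪[K] y ↔ x - y ∈ 𝓂[K] := fun x y => Ideal.Quotient.eq
  have hmem1 : ∀ z : 𝒪[K], z ∈ 𝓂[K] ↔ Valued.v (z : K) ≤ Valued.v ϖ := fun z => by
    rw [show 𝓂[K] = 𝓂[K] ^ 1 from (pow_one _).symm, mem_maximalIdeal_pow_iff_v_le hϖ, pow_one]
  have hres_lift : ∀ c : 𝓀[K], ∃ α : K, σ α = α ∧ ∃ hα : Valued.v α ≤ 1, IsLocalRing.residue 𝒪[K] (⟨α, hα⟩ : 𝒪[K]) = c := by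
    intro c
    obtain ⟨y, rfl⟩ := IsLocalRing.residue_surjective c
    obtain ⟨α, hα, hα1, hyα⟩ := exists_fixed_v_sub_le_varpi hD y.2
    refine ⟨α, hα, hα1, ?_⟩
    rw [eq_comm, hres_eq, hmem1]
    simpa using hyα
  choose clift hclift_fix hclift_int hclift_res using hres_lift
  -- fixed residues that agree are close to order `|ϖ|²`
  have hres_close : ∀ {α β : K} (hα : Valued.v α ≤ 1) (hβ : Valued.v β ≤ 1), σ α = α → σ β = β →
      IsLocalRing.residue 𝒪[K] (⟨α, hα⟩ : 𝒪[K]) = IsLocalRing.residue 𝒪[K] (⟨β, hβ⟩ : 𝒪[K]) → Valued.v (α - β) ≤ Valued.v ϖ ^ 2 := by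
    intro α β hα hβ hσα hσβ h
    rw [hres_eq, hmem1] at h
    have h' : Valued.v (α - β) ≤ Valued.v ϖ := by simpa using h
    exact v_le_varpi_sq_of_fixed_of_lt_one hD (by rw [map_sub, hσα, hσβ]) (h'.trans_lt hϖ1)
  -- the representative of the layer class `c`: `w_c = 1 + π^a c̃`
  let wc : 𝓀[K] → K := fun c => 1 + π ^ a * clift c
  have hwc_def : ∀ c, wc c = 1 + π ^ a * clift c := fun c => rfl
  have hwc_fix : ∀ c, σ (wc c) = wc c := fun c => by
    rw [hwc_def, map_add, map_one, map_mul, hσπa, hclift_fix]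
  have hwc_one : ∀ c, Valued.v (wc c - 1) ≤ Valued.v (ϖ ^ (2 * a)) := fun c => by
    rw [hwc_def, add_sub_cancel_left, map_mul, hvπa]
    exact mul_le_of_le_one_right' (hclift_int c)
  -- KEY: for `x` with `P x`, `Φ x = c ↔ Q (wc c) x`; and `Q (wc c) x → P x`
  have hQP : ∀ c x, Q (wc c) x → P x := by
    rintro c x ⟨u, hux, hcQ⟩
    refine ⟨u, hux, ?_⟩
    have hrew : (u : K) * σ u - 1 = ((u : K) * σ u - wc c) + (wc c - 1) := by ring
    rw [hrew]
    refine (Valuation.map_add _ _ _).trans (max_le (hcQ.trans ?_) (hwc_one c))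
    rw [hϖ2a2]; exact mul_le_of_le_one_right' (pow_le_one₀ zero_le hϖle)
  have hΦ_iff : ∀ c x, P x → (Φ x = c ↔ Q (wc c) x) := by
    intro c x hPx
    have hint := hγint x hPx
    have hΦx : Φ x = IsLocalRing.residue 𝒪[K] (⟨γ x, hint⟩ : 𝒪[K]) := dif_pos hint
    have hdiff : γ x - clift c = (((lift x : 𝒪[K]) : K) * σ (lift x) - wc c) / π ^ a := by
      rw [eq_div_iff hπa0, hγeq x, hwc_def]; ring
    have hstep1 : Φ x = c ↔ Valued.v (γ x - clift c) < 1 := by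
      rw [hΦx]
      have key : IsLocalRing.residue 𝒪[K] (⟨γ x, hint⟩ : 𝒪[K]) = IsLocalRing.residue 𝒪[K] (⟨clift c, hclift_int c⟩ : 𝒪[K]) ↔
          Valued.v (γ x - clift c) < 1 := by
        rw [hres_eq, hmem1]
        change Valued.v (γ x - clift c) ≤ Valued.v ϖ ↔ _
        exact ⟨fun h => h.trans_lt hϖ1, fun h => v_le_varpi_of_lt_one hϖ h⟩
      constructor
      · intro h; exact key.1 (h.trans (hclift_res c).symm)
      · intro h; exact (key.2 h).trans (hclift_res c)
    have hstep2 : Valued.v (γ x - clift c) < 1 ↔ Valued.v (γ x - clift c) ≤ Valued.v ϖ ^ 2 :=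
      ⟨fun h => v_le_varpi_sq_of_fixed_of_lt_one hD (by rw [map_sub, hγfix, hclift_fix]) h,
       fun h => h.trans_lt (by rw [← map_pow]; exact v_varpi_pow_lt_one hϖ (by norm_num))⟩
    have hstep3 : Valued.v (γ x - clift c) ≤ Valued.v ϖ ^ 2 ↔ Valued.v (((lift x : 𝒪[K]) : K) * σ (lift x) - wc c) ≤ Valued.v (ϖ ^ (2 * a + 2)) := by
      have hpos : 0 < Valued.v (π ^ a) := (Valuation.pos_iff _).2 hπa0
      rw [hdiff, map_div₀, div_le_iff₀ hpos, hvπa, hϖ2a2, mul_comm (Valued.v ϖ ^ 2) (Valued.v (ϖ ^ (2 * a)))]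
    rw [hstep1, hstep2, hstep3]
    constructor
    · intro h; exact ⟨lift x, hlift_spec x, h⟩
    · rintro ⟨u, hux, hcQ⟩
      have hrew : ((lift x : 𝒪[K]) : K) * σ (lift x) - wc c = (((lift x : 𝒪[K]) : K) * σ (lift x) - (u : K) * σ u) + ((u : K) * σ u - wc c) := by ring
      rw [hrew]
      refine (Valuation.map_add _ _ _).trans (max_le ?_ hcQ)
      rw [Valuation.map_sub_swap]; exact hNclose x u hux
  refine ⟨wc, hwc_fix, hwc_one, fun c c' => ?_, fun w' hσw' hw' => ?_, ?_⟩
  · -- additivity: `w_c w_{c′} − w_{c+c′} = π^a (c̃ + c̃′ − (c+c′)~) + π^{2a} c̃ c̃′`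
    have hsum_res : IsLocalRing.residue 𝒪[K] (⟨clift c + clift c', (Valuation.map_add _ _ _).trans (max_le (hclift_int c) (hclift_int c'))⟩ : 𝒪[K]) =
        IsLocalRing.residue 𝒪[K] (⟨clift (c + c'), hclift_int (c + c')⟩ : 𝒪[K]) := by
      have hadd : (⟨clift c + clift c', (Valuation.map_add _ _ _).trans (max_le (hclift_int c) (hclift_int c'))⟩ : 𝒪[K]) =
          (⟨clift c, hclift_int c⟩ : 𝒪[K]) + ⟨clift c', hclift_int c'⟩ := rfl
      rw [hadd, map_add, hclift_res, hclift_res, hclift_res]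
    have hclose := hres_close _ _ (by rw [map_add, hclift_fix, hclift_fix]) (hclift_fix _) hsum_res
    have hrew : wc c * wc c' - wc (c + c') = π ^ a * (clift c + clift c' - clift (c + c')) + π ^ a * π ^ a * (clift c * clift c') := by
      rw [hwc_def, hwc_def, hwc_def]; ring
    rw [hrew]
    refine (Valuation.map_add _ _ _).trans (max_le ?_ ?_)
    · rw [map_mul, hvπa, hϖ2a2]; exact mul_le_mul' le_rfl hclose
    · rw [map_mul, map_mul, hvπa, hϖ2a2, mul_assoc]
      refine mul_le_mul' le_rfl ?_
      calc Valued.v (ϖ ^ (2 * a)) * Valued.v (clift c * clift c') ≤ Valued.v (ϖ ^ (2 * a)) * 1 :=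
            mul_le_mul' le_rfl (by rw [map_mul]; exact mul_le_one' (hclift_int c) (hclift_int c'))
        _ ≤ Valued.v ϖ ^ 2 := by rw [mul_one, map_pow]; exact pow_le_pow_right_of_le_one' hϖle (by omega)
  · -- completeness: `w′ = 1 + π^a γ′`, `c := residue γ′`
    set γ' : K := (w' - 1) / π ^ a with hγ'
    have hγ'int : Valued.v γ' ≤ 1 := by rw [hγ', map_div₀, hvπa]; exact div_le_one_of_le₀ hw' zero_le
    have hγ'fix : σ γ' = γ' := by rw [hγ', map_div₀, map_sub, hσw', map_one, hσπa]
    refine ⟨IsLocalRing.residue 𝒪[K] ⟨γ', hγ'int⟩, ?_⟩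
    have hclose := hres_close hγ'int (hclift_int _) hγ'fix (hclift_fix _) (hclift_res _).symm
    have hπγ : π ^ a * γ' = w' - 1 := by rw [hγ', mul_div_cancel₀ _ hπa0]
    have hrew : w' - wc (IsLocalRing.residue 𝒪[K] ⟨γ', hγ'int⟩) = π ^ a * (γ' - clift (IsLocalRing.residue 𝒪[K] ⟨γ', hγ'int⟩)) := by
      rw [hwc_def, mul_sub, hπγ]; ring
    rw [hrew, map_mul, hvπa, hϖ2a2]
    exact mul_le_mul' le_rfl hclose
  · -- the partition of `Sol` by `Φ`
    have hsum : Nat.card {x // P x} = ∑ c : 𝓀[K], Nat.card {x : {x // P x} // Φ x.1 = c} := by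
      rw [← Nat.card_sigma]
      exact Nat.card_congr (Equiv.sigmaFiberEquiv fun x : {x // P x} => Φ x.1).symm
    have hfib : ∀ c : 𝓀[K], Nat.card {x : {x // P x} // Φ x.1 = c} = Nat.card {x // Q (wc c) x} := by
      intro c
      refine Nat.card_congr ((Equiv.subtypeSubtypeEquivSubtypeInter P (fun x => Φ x = c)).trans (Equiv.subtypeEquivRight fun x => ?_))
      exact ⟨fun ⟨hPx, hΦ⟩ => (hΦ_iff c x hPx).1 hΦ, fun hQ => ⟨hQP c x hQ, (hΦ_iff c x (hQP c x hQ)).2 hQ⟩⟩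
    rw [finsum_eq_sum_of_fintype, hsum]
    exact Finset.sum_congr rfl fun c _ => hfib c

/-- **THE LAYER COUNT.**  If every fixed unit `w ≡ 1 (mod 𝓂^{2a})` is a norm to tolerance `|ϖ^{2a+2}|` (below the break by ★ `exists_unit_v_sub_mul_map_le`, above the conductor by
★ `exists_mul_map_eq_of_fixed_of_v_sub_one_le_pred`), then `#Sol_{2a}(1) = q · #G_a` — every block of the layer partition is a translate of `G_a`.
[cite: Serre1979, Ch. V §3 Prop. 5, Cor. 2–3 pp. 84–86] [cite: LabesseLanglands1979, §2 p. 8] -/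
theorem natCard_normFibre_one_eq_card_mul_of_layer [IsDiscreteValuationRing 𝒪[K]] [Finite 𝓀[K]] (hD : IsRamifiedQuadraticDatum σ ϖ d t)
    (h2v : Valued.v (2 : K) < 1) {a : ℕ} (ha : 1 ≤ a)
    (hlayer : ∀ w : K, σ w = w → Valued.v (w - 1) ≤ Valued.v (ϖ ^ (2 * a)) → ∃ z : K, Valued.v z = 1 ∧ Valued.v (z * σ z - w) ≤ Valued.v (ϖ ^ (2 * a + 2))) :
    Nat.card {x : 𝒪[K] ⧸ 𝓂[K] ^ (2 * a) // ∃ u : 𝒪[K], Ideal.Quotient.mk (𝓂[K] ^ (2 * a)) u = x ∧ Valued.v ((u : K) * σ u - 1) ≤ Valued.v (ϖ ^ (2 * a))} =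
      Nat.card 𝓀[K] *
        Nat.card {x : 𝒪[K] ⧸ 𝓂[K] ^ (2 * a) // ∃ u : 𝒪[K], Ideal.Quotient.mk (𝓂[K] ^ (2 * a)) u = x ∧ Valued.v ((u : K) * σ u - 1) ≤ Valued.v (ϖ ^ (2 * a + 2))} := by
  classical
  haveI : Fintype 𝓀[K] := Fintype.ofFinite _
  have hvσ := hD.2.1
  obtain ⟨w, hwfix, hwone, -, -, hsum⟩ := exists_layer_partition hD h2v ha
  have hblock : ∀ c : 𝓀[K],
      Nat.card {x : 𝒪[K] ⧸ 𝓂[K] ^ (2 * a) // ∃ u : 𝒪[K], Ideal.Quotient.mk (𝓂[K] ^ (2 * a)) u = x ∧ Valued.v ((u : K) * σ u - w c) ≤ Valued.v (ϖ ^ (2 * a + 2))} =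
        Nat.card {x : 𝒪[K] ⧸ 𝓂[K] ^ (2 * a) // ∃ u : 𝒪[K], Ideal.Quotient.mk (𝓂[K] ^ (2 * a)) u = x ∧ Valued.v ((u : K) * σ u - 1) ≤ Valued.v (ϖ ^ (2 * a + 2))} := by
    intro c
    obtain ⟨z, hz1, hz⟩ := hlayer (w c) (hwfix c) (hwone c)
    symm
    exact natCard_normFibre_eq_of_approx' hvσ (2 * a) (2 * a + 2) hz1 (by rw [mul_one]; exact hz)
  rw [hsum, finsum_eq_sum_of_fintype, Finset.sum_congr rfl fun c _ => hblock c, Finset.sum_const, Finset.card_univ, smul_eq_mul,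
    ← Nat.card_eq_fintype_card]

/-! ## §4 The values below the conductor -/

/-- **BELOW THE BREAK THE LAYER IS FULL**: for `a + 2 ≤ d` every fixed unit is a norm to order `2(d − 1) ≥ 2a + 2`, so `#Sol_{2a}(1) = q · #G_a`.
[cite: Serre1979, Ch. V §3 Prop. 5, Cor. 2–3 pp. 84–86] -/
theorem natCard_normFibre_one_eq_card_mul_of_add_two_le [IsDiscreteValuationRing 𝒪[K]] [Finite 𝓀[K]] (hD : IsRamifiedQuadraticDatum σ ϖ d t)
    (h2v : Valued.v (2 : K) < 1) {a : ℕ} (ha : 1 ≤ a) (had : a + 2 ≤ d) :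
    Nat.card {x : 𝒪[K] ⧸ 𝓂[K] ^ (2 * a) // ∃ u : 𝒪[K], Ideal.Quotient.mk (𝓂[K] ^ (2 * a)) u = x ∧ Valued.v ((u : K) * σ u - 1) ≤ Valued.v (ϖ ^ (2 * a))} =
      Nat.card 𝓀[K] *
        Nat.card {x : 𝒪[K] ⧸ 𝓂[K] ^ (2 * a) // ∃ u : 𝒪[K], Ideal.Quotient.mk (𝓂[K] ^ (2 * a)) u = x ∧ Valued.v ((u : K) * σ u - 1) ≤ Valued.v (ϖ ^ (2 * a + 2))} := by
  have hvσ := hD.2.1; have hϖ := hD.2.2.1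
  refine natCard_normFibre_one_eq_card_mul_of_layer hD h2v ha fun w hσw hw1 => ?_
  have hlt : Valued.v (w - 1) < 1 := hw1.trans_lt (v_varpi_pow_lt_one hϖ (by omega))
  have hw : Valued.v w = 1 := by
    have h1 : Valued.v (w - 1) < Valued.v (1 : K) := by rw [map_one]; exact hlt
    have := Valuation.map_eq_of_sub_lt Valued.v h1; rwa [map_one] at this
  obtain ⟨z, hz1, hz⟩ := exists_unit_v_sub_mul_map_le hD h2v hσw hw
  refine ⟨z, hz1, ?_⟩
  rw [Valuation.map_sub_swap]
  refine hz.trans ?_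
  rw [map_pow, v_varpi_pow hϖ, exp_le_exp]
  omega

/-- **THE VALUES BELOW THE CONDUCTOR: `#Sol_{2a}(1) = q^a` for `1 ≤ a ≤ d − 1`** — induction on `a` from `#Sol_2(1) = q` (★ Part I §5) through the lifting step
`#Sol_{2a+2}(1) = q²·#G_a` (★ Part I §6) and the layer count `#Sol_{2a}(1) = q·#G_a` (§3∕§4). [cite: Serre1979, Ch. V §3 Prop. 5, Cor. 2–3 pp. 84–86] [cite: LabesseLanglands1979, §2 p. 8] -/
theorem natCard_normFibre_one_eq_pow [IsDiscreteValuationRing 𝒪[K]] [Finite 𝓀[K]] (hD : IsRamifiedQuadraticDatum σ ϖ d t)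
    (h2v : Valued.v (2 : K) < 1) {a : ℕ} (ha : 1 ≤ a) (had : a + 1 ≤ d) :
    Nat.card {x : 𝒪[K] ⧸ 𝓂[K] ^ (2 * a) // ∃ u : 𝒪[K], Ideal.Quotient.mk (𝓂[K] ^ (2 * a)) u = x ∧ Valued.v ((u : K) * σ u - 1) ≤ Valued.v (ϖ ^ (2 * a))} =
      Nat.card 𝓀[K] ^ a := by
  induction a, ha using Nat.le_induction with
  | base =>
    rw [pow_one]; exact natCard_normFibre_one_two hD h2v
  | succ a ha ih =>
    have hstep := natCard_normFibre_one_succ hD h2v ha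
    have hlayer := natCard_normFibre_one_eq_card_mul_of_add_two_le hD h2v ha (by omega)
    have hq : 0 < Nat.card 𝓀[K] := Nat.card_pos
    rw [show 2 * (a + 1) = 2 * a + 2 by ring, hstep]
    -- `q² · G = q · (q · G) = q · Sol = q · q^a`
    have hih := ih (by omega)
    rw [hlayer] at hih
    rw [show Nat.card 𝓀[K] ^ (a + 1) = Nat.card 𝓀[K] ^ a * Nat.card 𝓀[K] from pow_succ _ _, ← hih]; ring

/-- **THE CLASS-BLIND GLUE COUNT: `#Sol_{2a}(r) = q^a` for EVERY fixed unit `r` and `1 ≤ a ≤ d − 1`** (★ Part I §3 + §4 above) — the value `A(a, ξ) = q^a` of the wild toric census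
below the conductor. [cite: Serre1979, Ch. V §3 Prop. 5, Cor. 2–3 pp. 84–86] [cite: LabesseLanglands1979, §2 p. 8] -/
theorem natCard_normFibre_eq_pow_of_succ_le [IsDiscreteValuationRing 𝒪[K]] [Finite 𝓀[K]] (hD : IsRamifiedQuadraticDatum σ ϖ d t)
    (h2v : Valued.v (2 : K) < 1) {r : K} (hσr : σ r = r) (hr : Valued.v r = 1) {a : ℕ} (ha : 1 ≤ a) (had : a + 1 ≤ d) :
    Nat.card {x : 𝒪[K] ⧸ 𝓂[K] ^ (2 * a) // ∃ u : 𝒪[K], Ideal.Quotient.mk (𝓂[K] ^ (2 * a)) u = x ∧ Valued.v ((u : K) * σ u - r) ≤ Valued.v (ϖ ^ (2 * a))} =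
      Nat.card 𝓀[K] ^ a := by
  rw [natCard_normFibre_eq_natCard_normFibre_one_of_succ_le hD h2v hσr hr had]
  exact natCard_normFibre_one_eq_pow hD h2v ha had

end Literature.NumberTheory.LocalFields.WildQuadraticDatum

end
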